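import Mathlib
import HarnessLib
import Summits.ResolutionOfSingularities.ResolutionOfSingularities.Theorems.WildQuotientsWildQuotientResolutionS1aCobordantAway

/-!
# S1a — THE KILL CLAUSE LOCALISES (ring level, part 2): chart rings of the localised node are chart rings of the node

[OURS · L1 W4.5c · lead-1 g8; infrastructure for `PrincipalCentreChartShrink` (support form) / `KillableAtOfIdle` / (A3)] — NOT statements of
the manuscript; counted 0; AI-level work, weaker than expert review. Crux stmt-ResolutionOfSingularities-17941, line `s1a-logminvertex` v6.
Pure commutative algebra, route-independent.

For a node `(B, 𝒜, σ)` with centre `(f, w)`, `h ∈ 𝒜 0` `σ`-invariant, `B' = B[h⁻¹]`, `f' = f/1`, `σ' = sigmaAway σ`, `β₀ ∈ K_{d'}`: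
* `baseChangeAlgebra h f w` — `R^w(B')` as an `R^w(B)`-algebra (then every chart ring of the localised node is an `R^w(B)`-algebra in a
  scalar tower, by Mathlib's `OreLocalization` instances);
* `isLocalization_away_chartRing` — `R^w(B')[((β₀/hᵏ)T^{d'})⁻¹]` is the localisation of `R^w(B)` away from `(hβ₀)T^{d'}`
  (`IsLocalization.Away.mul_of_associated`), whence **`chartRingAwayEquiv : R^w(B)[((hβ₀)T^{d'})⁻¹] ≃ₐ R^w(B')[((β₀/hᵏ)T^{d'})⁻¹]`**
  with the pin `chartRingAwayEquiv_algebraMap` and the σ-equivariance `chartRingAwayEquiv_sigmaChart`;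
* **`kill_away`** — THE KILL CLAUSE OF `IsPrincipalCentreChart` FOR THE LOCALISED DATA `(B', locPiece, σ')` follows from the kill clause of
  `(B, 𝒜, σ)`.
-/

set_option linter.dupNamespace false

noncomputable section

open DirectSum Literature.AlgebraicGeometry.Resolution
open scoped LaurentPolynomial
open Summit.ResolutionOfSingularities.ResolutionOfSingularities.Theorems.WildQuotientResolution.S1.GradedLocalization
open Summit.ResolutionOfSingularities.ResolutionOfSingularities.Theorems.WildQuotientResolution.S1.NodeAway
open Summit.ResolutionOfSingularities.ResolutionOfSingularities.Theorems.WildQuotientResolution.S1.CoarseChart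
open Summit.ResolutionOfSingularities.ResolutionOfSingularities.Theorems.WildQuotientResolution.S1.CentreAway

namespace Summit.ResolutionOfSingularities.ResolutionOfSingularities.Theorems.WildQuotientResolution.S1.PrincipalAway

universe u v

/-! ## The chart rings of the localised node -/

section ChartIso

variable {ι : Type v} [AddCommGroup ι] [DecidableEq ι] {B : Type u} [CommRing B] (𝒜 : ι → AddSubgroup B) [GradedRing 𝒜]
  {h : B} (hh : h ∈ 𝒜 0) {c : ℕ} (f : Fin c → B) (w : Fin c → ℕ)

/-- `h β₀ ∈ K_{d'}`. -/
theorem hmul_mem (d' : ℕ) (β₀ : ↥(𝒜 0)) (hβ₀ : β₀ ∈ (traceFiltration 𝒜 f w).ideal d') :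
    (⟨h, hh⟩ : ↥(𝒜 0)) * β₀ ∈ (traceFiltration 𝒜 f w).ideal d' :=
  Ideal.mul_mem_left _ _ hβ₀

/-- `β₀/hᵏ ∈ K_{d'}(B[h⁻¹])`. -/
theorem frac_mem (d' : ℕ) (β₀ : ↥(𝒜 0)) (hβ₀ : β₀ ∈ (traceFiltration 𝒜 f w).ideal d') (k : ℕ) :
    letI := locGradedRing 𝒜 hh
    zeroToAwayZero 𝒜 hh β₀ * invSelfZero 𝒜 hh ^ k ∈
      (traceFiltration (locPiece 𝒜 hh) (algebraMap B (Localization.Away h) ∘ f) w).ideal d' := by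
  letI := locGradedRing 𝒜 hh
  rw [traceFiltration_away]
  exact Ideal.mul_mem_right _ _ (Ideal.mem_map_of_mem _ hβ₀)

/-- In `R^w(B)`: `C h · (β₀ T^{d'}) = (h β₀) T^{d'}`. -/
theorem algebraMap_mul_coverElement (d' : ℕ) (β₀ : ↥(𝒜 0)) (hβ₀ : β₀ ∈ (traceFiltration 𝒜 f w).ideal d') :
    algebraMap B (↥(cobordantAlgebra f w)) h * coverElement 𝒜 f w d' β₀ hβ₀ =
      coverElement 𝒜 f w d' ((⟨h, hh⟩ : ↥(𝒜 0)) * β₀) (hmul_mem 𝒜 hh f w d' β₀ hβ₀) := by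
  refine Subtype.ext ?_
  rw [MulMemClass.coe_mul, cobordantAlgebra.coe_algebraMap, coe_coverElement, coe_coverElement, SetLike.GradeZero.coe_mul, map_mul,
    mul_assoc]

/-- In `R^w(B[h⁻¹])`: the base change of `β₀ T^{d'}` is associated with `(β₀/hᵏ) T^{d'}`. -/
theorem associated_cobordantMap_coverElement (d' : ℕ) (β₀ : ↥(𝒜 0)) (hβ₀ : β₀ ∈ (traceFiltration 𝒜 f w).ideal d') (k : ℕ) :
    letI := locGradedRing 𝒜 hh
    Associated (cobordantMap f w h (coverElement 𝒜 f w d' β₀ hβ₀))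
      (coverElement (locPiece 𝒜 hh) (algebraMap B (Localization.Away h) ∘ f) w d'
        (zeroToAwayZero 𝒜 hh β₀ * invSelfZero 𝒜 hh ^ k) (frac_mem 𝒜 hh f w d' β₀ hβ₀ k)) := by
  letI := locGradedRing 𝒜 hh
  have hu : IsUnit (algebraMap (Localization.Away h) (↥(cobordantAlgebra (algebraMap B (Localization.Away h) ∘ f) w))
      (IsLocalization.Away.invSelf h) ^ k) :=
    ((IsUnit.of_mul_eq_one_right _ (IsLocalization.Away.mul_invSelf (S := Localization.Away h) h)).map _).pow k
  refine ⟨hu.unit, Subtype.ext ?_⟩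
  rw [MulMemClass.coe_mul, IsUnit.unit_spec, SubmonoidClass.coe_pow, cobordantAlgebra.coe_algebraMap, coe_cobordantMap, coe_coverElement,
    coe_coverElement, mapRingHom_C_mul_T]
  change _ = LaurentPolynomial.C (algebraMap B (Localization.Away h) (β₀ : B) * IsLocalization.Away.invSelf h ^ k) * _
  rw [map_mul, map_pow]
  ring

variable (h) in
/-- The `R^w(B)`-algebra structure of `R^w(B[h⁻¹])` through `cobordantMap` (whence, by Mathlib's `OreLocalization` instances, every
chart ring of the localised node is an `R^w(B)`-algebra in a scalar tower). -/
@[reducible] def baseChangeAlgebra : Algebra ↥(cobordantAlgebra f w) ↥(cobordantAlgebra (algebraMap B (Localization.Away h) ∘ f) w) :=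
  (cobordantMap f w h).toAlgebra

/-- **The chart ring `R^w(B[h⁻¹])[((β₀/hᵏ)T^{d'})⁻¹]` is the localisation of `R^w(B)` away from `(hβ₀)T^{d'}`.** [OURS · L1 W4.5c] -/
theorem isLocalization_away_chartRing (d' : ℕ) (β₀ : ↥(𝒜 0)) (hβ₀ : β₀ ∈ (traceFiltration 𝒜 f w).ideal d') (k : ℕ) :
    letI := locGradedRing 𝒜 hh
    letI := baseChangeAlgebra h f w
    IsLocalization.Away (coverElement 𝒜 f w d' ((⟨h, hh⟩ : ↥(𝒜 0)) * β₀) (hmul_mem 𝒜 hh f w d' β₀ hβ₀))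
      (ChartRing (locPiece 𝒜 hh) (algebraMap B (Localization.Away h) ∘ f) w d'
        (zeroToAwayZero 𝒜 hh β₀ * invSelfZero 𝒜 hh ^ k) (frac_mem 𝒜 hh f w d' β₀ hβ₀ k)) := by
  letI := locGradedRing 𝒜 hh
  letI := baseChangeAlgebra h f w
  haveI : IsLocalization.Away (algebraMap B (↥(cobordantAlgebra f w)) h) (↥(cobordantAlgebra (algebraMap B (Localization.Away h) ∘ f) w)) :=
    isLocalization_away_cobordantMap f w h
  rw [← algebraMap_mul_coverElement 𝒜 hh f w d' β₀ hβ₀]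
  exact IsLocalization.Away.mul_of_associated (S := ↥(cobordantAlgebra (algebraMap B (Localization.Away h) ∘ f) w)) _ _ _
    (associated_cobordantMap_coverElement 𝒜 hh f w d' β₀ hβ₀ k)

/-- **THE CHART RINGS OF THE LOCALISED NODE ARE CHART RINGS OF THE NODE**:
`R^w(B)[((hβ₀)T^{d'})⁻¹] ≃ₐ R^w(B[h⁻¹])[((β₀/hᵏ)T^{d'})⁻¹]` over `R^w(B)`. [OURS · L1 W4.5c] -/
def chartRingAwayEquiv (d' : ℕ) (β₀ : ↥(𝒜 0)) (hβ₀ : β₀ ∈ (traceFiltration 𝒜 f w).ideal d') (k : ℕ) :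
    letI := locGradedRing 𝒜 hh
    letI := baseChangeAlgebra h f w
    ChartRing 𝒜 f w d' ((⟨h, hh⟩ : ↥(𝒜 0)) * β₀) (hmul_mem 𝒜 hh f w d' β₀ hβ₀) ≃ₐ[↥(cobordantAlgebra f w)]
      ChartRing (locPiece 𝒜 hh) (algebraMap B (Localization.Away h) ∘ f) w d'
        (zeroToAwayZero 𝒜 hh β₀ * invSelfZero 𝒜 hh ^ k) (frac_mem 𝒜 hh f w d' β₀ hβ₀ k) :=
  letI := locGradedRing 𝒜 hh
  letI := baseChangeAlgebra h f w
  haveI := isLocalization_away_chartRing 𝒜 hh f w d' β₀ hβ₀ k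
  IsLocalization.algEquiv (Submonoid.powers (coverElement 𝒜 f w d' ((⟨h, hh⟩ : ↥(𝒜 0)) * β₀) (hmul_mem 𝒜 hh f w d' β₀ hβ₀))) _ _

/-- Pin: `chartRingAwayEquiv` on the image of `R^w(B)`. -/
theorem chartRingAwayEquiv_algebraMap (d' : ℕ) (β₀ : ↥(𝒜 0)) (hβ₀ : β₀ ∈ (traceFiltration 𝒜 f w).ideal d') (k : ℕ)
    (z : ↥(cobordantAlgebra f w)) :
    letI := locGradedRing 𝒜 hh
    chartRingAwayEquiv 𝒜 hh f w d' β₀ hβ₀ k (algebraMap _ _ z) =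
      algebraMap (↥(cobordantAlgebra (algebraMap B (Localization.Away h) ∘ f) w)) _ (cobordantMap f w h z) := by
  letI := locGradedRing 𝒜 hh
  letI := baseChangeAlgebra h f w
  exact ((chartRingAwayEquiv 𝒜 hh f w d' β₀ hβ₀ k).commutes z).trans (IsScalarTower.algebraMap_apply _ _ _ z)

variable (σ : B ≃+* B) (hσJ : ∀ n : ℕ, ((weightedFiltration f w).ideal n).map (σ : B →+* B) ≤ (weightedFiltration f w).ideal n)
  {p : ℕ} (hp : 0 < p) (hσp : ∀ x : B, (⇑σ)^[p] x = x) (hσh : σ h = h)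

include hσh in
/-- `σ (h β₀) = h β₀` for invariant `β₀`. -/
theorem sigma_hmul (β₀ : ↥(𝒜 0)) (hσβ₀ : σ (β₀ : B) = β₀) :
    σ ((((⟨h, hh⟩ : ↥(𝒜 0)) * β₀ : ↥(𝒜 0)) : B)) = (((⟨h, hh⟩ : ↥(𝒜 0)) * β₀ : ↥(𝒜 0)) : B) := by
  rw [SetLike.GradeZero.coe_mul, map_mul, hσh, hσβ₀]

/-- `σ' (β₀/hᵏ) = β₀/hᵏ` for invariant `β₀`. -/
theorem sigmaAway_frac (β₀ : ↥(𝒜 0)) (k : ℕ) (hσβ₀ : σ (β₀ : B) = β₀) : letI := locGradedRing 𝒜 hh;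
    sigmaAway σ hσh (((zeroToAwayZero 𝒜 hh β₀ * invSelfZero 𝒜 hh ^ k : ↥(locPiece 𝒜 hh 0)) : Localization.Away h)) =
      ((zeroToAwayZero 𝒜 hh β₀ * invSelfZero 𝒜 hh ^ k : ↥(locPiece 𝒜 hh 0)) : Localization.Away h) := by
  letI := locGradedRing 𝒜 hh
  change sigmaAway σ hσh (algebraMap B (Localization.Away h) (β₀ : B) * IsLocalization.Away.invSelf h ^ k) =
    algebraMap B (Localization.Away h) (β₀ : B) * IsLocalization.Away.invSelf h ^ k
  rw [sigmaAway_mk, hσβ₀]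

/-- **`chartRingAwayEquiv` intertwines the two lifted automorphisms `sigmaChart`.** [OURS · L1 W4.5c] -/
theorem chartRingAwayEquiv_sigmaChart (d' : ℕ) (β₀ : ↥(𝒜 0)) (hβ₀ : β₀ ∈ (traceFiltration 𝒜 f w).ideal d') (k : ℕ)
    (hσβ₀ : σ (β₀ : B) = β₀) (x : ChartRing 𝒜 f w d' ((⟨h, hh⟩ : ↥(𝒜 0)) * β₀) (hmul_mem 𝒜 hh f w d' β₀ hβ₀)) :
    letI := locGradedRing 𝒜 hh
    chartRingAwayEquiv 𝒜 hh f w d' β₀ hβ₀ k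
        (sigmaChart 𝒜 f w d' _ (hmul_mem 𝒜 hh f w d' β₀ hβ₀) σ hσJ hp hσp (sigma_hmul 𝒜 hh σ hσh β₀ hσβ₀) x) =
      sigmaChart (locPiece 𝒜 hh) (algebraMap B (Localization.Away h) ∘ f) w d' _ (frac_mem 𝒜 hh f w d' β₀ hβ₀ k)
        (sigmaAway σ hσh) (map_sigmaAway_weightedFiltration_le f w σ hσh hσJ) hp (sigmaAway_iterate_eq_self σ hσh hσp)
        (sigmaAway_frac 𝒜 hh σ hσh β₀ k hσβ₀)
        (chartRingAwayEquiv 𝒜 hh f w d' β₀ hβ₀ k x) := by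
  letI := locGradedRing 𝒜 hh
  letI := baseChangeAlgebra h f w
  -- both sides are ring homs out of a localisation of `R^w(B)`; compare them on `R^w(B)`
  set Θ := chartRingAwayEquiv 𝒜 hh f w d' β₀ hβ₀ k with hΘdef
  set τ := sigmaChart 𝒜 f w d' _ (hmul_mem 𝒜 hh f w d' β₀ hβ₀) σ hσJ hp hσp (sigma_hmul 𝒜 hh σ hσh β₀ hσβ₀) with hτdef
  set τ' := sigmaChart (locPiece 𝒜 hh) (algebraMap B (Localization.Away h) ∘ f) w d' _ (frac_mem 𝒜 hh f w d' β₀ hβ₀ k)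
        (sigmaAway σ hσh) (map_sigmaAway_weightedFiltration_le f w σ hσh hσJ) hp (sigmaAway_iterate_eq_self σ hσh hσp)
        (sigmaAway_frac 𝒜 hh σ hσh β₀ k hσβ₀) with hτ'def
  suffices H : Θ.toRingEquiv.toRingHom.comp τ.toRingHom = τ'.toRingHom.comp Θ.toRingEquiv.toRingHom from RingHom.congr_fun H x
  refine IsLocalization.ringHom_ext (Submonoid.powers (coverElement 𝒜 f w d' ((⟨h, hh⟩ : ↥(𝒜 0)) * β₀) (hmul_mem 𝒜 hh f w d' β₀ hβ₀)))
    (RingHom.ext fun z => ?_)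
  change Θ (τ (algebraMap _ _ z)) = τ' (Θ (algebraMap _ _ z))
  rw [hτdef, sigmaChart_algebraMap, hΘdef, chartRingAwayEquiv_algebraMap, chartRingAwayEquiv_algebraMap, hτ'def, sigmaChart_algebraMap,
    cobordantMap_sigmaR]

/-! ## The kill clause localises -/

/-- **THE KILL CLAUSE OF `IsPrincipalCentreChart` LOCALISES.** If every chart ring `R^w(B)[(bT^{d'})⁻¹]` (`b ∈ K_{d'}` `σ`-invariant,
`0 < d'`) is killed (principal augmentation ideal of `sigmaChart`), then so is every chart ring of the localised node
`(B[h⁻¹], locPiece, σ_h)`. [OURS · L1 W4.5c] -/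
theorem kill_away
    (hkill : ∀ (d' : ℕ) (b : ↥(𝒜 0)) (hb : b ∈ (traceFiltration 𝒜 f w).ideal d') (hσb : σ (b : B) = b), 0 < d' →
      (augmentationIdeal (sigmaChart 𝒜 f w d' b hb σ hσJ hp hσp hσb)).IsPrincipal) :
    letI := locGradedRing 𝒜 hh
    ∀ (hp' : 0 < p) (hσp' : ∀ x : Localization.Away h, (⇑(sigmaAway σ hσh))^[p] x = x) (d' : ℕ) (β : ↥(locPiece 𝒜 hh 0))
      (hβ : β ∈ (traceFiltration (locPiece 𝒜 hh) (algebraMap B (Localization.Away h) ∘ f) w).ideal d')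
      (hσβ : sigmaAway σ hσh (β : Localization.Away h) = β), 0 < d' →
      (augmentationIdeal (sigmaChart (locPiece 𝒜 hh) (algebraMap B (Localization.Away h) ∘ f) w d' β hβ (sigmaAway σ hσh)
        (map_sigmaAway_weightedFiltration_le f w σ hσh hσJ) hp' hσp' hσβ)).IsPrincipal := by
  letI := locGradedRing 𝒜 hh
  letI := baseChangeAlgebra h f w
  intro hp' hσp' d' β hβ hσβ hd'
  obtain ⟨k, β₀, hβ₀, hσβ₀, rfl⟩ := exists_invariant_of_mem_traceFiltration_away 𝒜 hh f w σ hσh β hβ hσβ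
  exact isPrincipal_augmentationIdeal_of_semiconj (chartRingAwayEquiv 𝒜 hh f w d' β₀ hβ₀ k).toRingEquiv _ _
    (chartRingAwayEquiv_sigmaChart 𝒜 hh f w σ hσJ hp hσp hσh d' β₀ hβ₀ k hσβ₀)
    (hkill d' _ (hmul_mem 𝒜 hh f w d' β₀ hβ₀) (sigma_hmul 𝒜 hh σ hσh β₀ hσβ₀) hd')

end ChartIso

end Summit.ResolutionOfSingularities.ResolutionOfSingularities.Theorems.WildQuotientResolution.S1.PrincipalAway

end
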